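import Summits.Ventures.CertifiedManyBodySolver.Observables.PolarisedClassExclusionObjectE
import Summits.Ventures.CertifiedManyBodySolver.Observables.MeanFieldClassExclusionPolarisedCapV2LaUnderdoped
import Literature.MathematicalPhysics.QuantumLattice.HubbardFermiSeaFourCornerRowsB
import Literature.MathematicalPhysics.QuantumLattice.HubbardFermiSeaFourCornerRowsHigh
import Literature.MathematicalPhysics.QuantumLattice.HubbardFermiSeaTangentRowsHigh
import Summits.Ventures.CertifiedManyBodySolver.Certificates.HubbardSquare_afhfCap_n1_U10
import Summits.Ventures.CertifiedManyBodySolver.Certificates.HubbardSquare_afhfCap_n1_U12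
import Summits.Ventures.CertifiedManyBodySolver.Certificates.HubbardSquare_afhfCap_n1_U14p7
import Summits.Ventures.CertifiedManyBodySolver.Certificates.HubbardSquare_afhfCap_n1_U16p7
import Summits.Ventures.CertifiedManyBodySolver.Certificates.HubbardSquare_afhfCap_n1_U7
import Summits.Ventures.CertifiedManyBodySolver.Certificates.HubbardSquare_afhfCap_n1_U8p5
import HarnessLib

/-!
# Ventures/CertifiedManyBodySolver — Observables/PolarisedClassExclusionAFCap.lean

HONEST FRAMING: first certified bounds; not a superconductivity verdict; every number certified or labelled float.
A competing-order EXCLUSION removes a named class of candidate ground states; it never says which order is present;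
no phase sentence follows.

Cell `hubbard-tc` (MO-S3, D-0096), seat `hubbard-tc-mod-3` (G3), `prover-hubbard-tc-mod-3-g6-0`. **HYPOTHESIS-FREE editions of the SATURATED-FM
exclusion words near half filling** (`PolarisedClassExclusionObjectE.lean`, `…LaV2/LaU10.lean`, `ClassExclusionEdopedImages.lean` took the CERTIFIED
half-filling anchors #469 / #470 / #471 as hypotheses). Here the cap is the VACUUM CHORD `n·C_{U₂}` of hubbard-box-p2's KERNEL-CHECKED antiferromagnetic
Hartree–Fock cap plane at half filling (`afhfCap_n1_U…_at`: `e₀(1, t', U, 1) ≤ C_{U₂}` for every `t'` and every `U ≤ U₂`; `QFK.Cert`, no hypothesis),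
read down in `U` by monotonicity (`polar_word_of_cap`); the floor of the polarised class is `½·e(1, t', 0, 2n)` bounded below by kernel Fermi-sea rows at
density `2n` (`HubbardFermiSeaTangentRowsHigh`, `HubbardFermiSeaFourCornerRowsHigh`) read between two columns by concavity (`objE_floor_between`).
Statement (Tasaki 1998 Thm 6.1 logic): `e(1, t', U, n) < ½·e(1, t', 0, 2n)` ⇒ no fully polarised ground state.

* `laP_x0_lt_polarised` — La₂CuO₄ parent (VSET M13), La object E `[5.9, 14.7] × [−0.30, −0.20]`, hole half: `n` from `99/100` to `1`, every `0 ≤ U ≤ 167/10` (box `[5.9, 14.7]`; before: laE_x0_lt_polarised_of (WHOLE box U ≤ 16; cond. #469));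
* `laP_x003_hi_lt_polarised` — La₁.₉₇Sr₀.₀₃CuO₄ x = 0.03: `n` from `97/100` to `99/100`, every `0 ≤ U ≤ 167/10` (box `[5.9, 14.7]`; before: laE_x003_lt_polarised_of (whole box; cond.));
* `laP_x003_lo_lt_polarised` — La₁.₉₇Sr₀.₀₃CuO₄ x = 0.03: `n` from `19/20` to `97/100`, every `0 ≤ U ≤ 147/10` (box `[5.9, 14.7]`; before: laE_x003_lt_polarised_of (whole box; cond.));
* `laP_x005_lt_polarised` — La₁.₉₅Sr₀.₀₅CuO₄ x = 0.05: `n` from `93/100` to `97/100`, every `0 ≤ U ≤ 10` (box `[5.9, 14.7]`; before: laE_x005_lt_polarised_U10_of (U ≤ 10; cond. #471));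
* `laP_x007_lt_polarised` — La₁.₉₃Sr₀.₀₇CuO₄ x = 0.07 (VSET M14): `n` from `91/100` to `19/20`, every `0 ≤ U ≤ 17/2` (box `[5.9, 14.7]`; before: laE_x007_lt_polarised_U10_of (U ≤ 10; cond. #471 + docc tangent));
* `ccocP_parent_lt_polarised` — Ca₂CuO₂Cl₂ parent (VSET M58), BOX #28 object E `[7.1, 12.4] × [−0.41, −0.30]`, hole half: `n` from `99/100` to `1`, every `0 ≤ U ≤ 167/10` (box `[7.1, 12.4]`; before: ccocE_parent_lt_polarised_of (WHOLE box U ≤ 16; cond. #469));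
* `ncoP_parent_lt_polarised` — Nd₂CuO₄ T′ parent (VSET M56), object E hole half direct `[2.17, 7.24] × [−0.57, −0.46]`: `n` from `99/100` to `1`, every `0 ≤ U ≤ 12` (box `[2.17, 7.24]`; before: ncoE_parent_lt_polarised_of (WHOLE box U ≤ 16; cond. #469));
* `ncoP_parent_image_lt_polarised` — Nd₂CuO₄ T′ parent (VSET M56), electron half via the image `t′ ∈ [0.46, 0.57]`: `n` from `99/100` to `1`, every `0 ≤ U ≤ 12` (box `[2.17, 7.24]`; before: ncoE_parent_image_lt_polarised_of (WHOLE box U ≤ 16; cond. #469));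
* `nccoP_x015_lt_polarised` — Nd₁.₈₅Ce₀.₁₅CuO₄ (VSET M20), PH-image face `t′ ∈ [0.51, 0.62]` of the object-E box `[2.4, 8.23] × [−0.62, −0.51] × [1.09, 1.17]`: `n` from `83/100` to `91/100`, every `0 ≤ U ≤ 7` (box `[2.4, 8.23]`; before: nccoE_x015_lt_polarised_U8_of (U ≤ 8; cond. #472) / nccoE_x015_lt_polarised_of (U ≤ 6; cond. #21));
* `nccoP_x010_lt_polarised` — Nd₁.₉Ce₀.₁CuO₄ (VSET M55, control), PH-image face `t′ ∈ [0.49, 0.62]` ⊇ [0.499, 0.613] of the object-E box `[2.41, 8.37]`: `n` from `22/25` to `47/50`, every `0 ≤ U ≤ 10` (box `[2.41, 8.37]`; before: nccoE_x010_lt_polarised_U10_of (U ≤ 10 ⊇ whole box; cond. #471));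
* `slcoP_x010_lt_polarised` — Sr₀.₉La₀.₁CuO₂ (VSET M37), PH-image face `t′ ∈ [0.54, 0.65]` of the object-E box `[2.42, 11.24]`: `n` from `89/100` to `91/100`, every `0 ≤ U ≤ 10` (box `[2.42, 11.24]`; before: slcoE_x010_lt_polarised_of (U ≤ 12 ⊇ whole box; cond. #470));

NEW COVERAGE: none beyond the conditional words (La x = 0.07 reaches `U ≤ 8.5` here vs `10` with #471; Nd₁.₈₅Ce₀.₁₅CuO₄ `U ≤ 7` vs `8`; Sr₀.₉La₀.₁CuO₂ `U ≤ 10` vs `12`)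
— the merit is the absence of claim nodes: La x = 0 / 0.03, Ca₂CuO₂Cl₂ parent, Nd₂CuO₄ parent (both halves) and Nd₁.₉Ce₀.₁CuO₄ (M55) are WHOLE-box
hypothesis-free; La 0.05 to `U ≤ 10` as before. Deeper-doped boxes carry no FM word
by content (the polarised sea is a genuine competitor there). Exact margins (designer `hubbard-tc-mod-3/g6-replay/editions/fm_editions.py`) in each docstring.
WHAT THIS IS NOT: a statement about partially polarised or Néel order; tight; a phase word.

References: Lieb–Loss, Duke Math. J. 71 (1993) 337, §8 Thm 8.2 [LiebLoss1993]; H. Tasaki, Prog. Theor. Phys. 99 (1998) 489, §2 Def. 2.1, §6 Thm. 6.1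
[Tasaki1998]; Bach–Lieb–Solovej, J. Stat. Phys. 76 (1994) 3, eq. (2c.36) [BachLiebSolovej1994]; Israel (1979) Thm I.3.4 [Israel1979].
-/

noncomputable section

namespace Summit.Ventures.CertifiedManyBodySolver.Observables

open Literature.MathematicalPhysics.QuantumLattice
open Literature.MathematicalPhysics.QuantumLattice.ThermodynamicLimit
open Summit.Ventures.CertifiedManyBodySolver.Certificates
open Matrix HubbardWave0 Literature.Probability.LatticeModels Filter Topology Set
open scoped ComplexOrder BigOperators

/-- **La₂CuO₄ parent (VSET M13), La object E `[5.9, 14.7] × [−0.30, −0.20]`, hole half, `t' ∈ [-3/10, -1/5]`, `n ∈ [99/100, 1)`: the SATURATED-FM class is excluded for every `0 ≤ U ≤ 167/10`, HYPOTHESIS-FREE** (box `U/t_eff ∈ [5.9, 14.7]`; before: laE_x0_lt_polarised_of (WHOLE box U ≤ 16; cond. #469)): `e(1, t', U, n) < ½·e(1, t', 0, 2n)` = the one-species bathtub floor of every fully polarised state. Cap at `U = 167/10` = vacuum chord `n·C` of hubbard-box-p2's KERNEL AF-Hartree–Fock half-filling cap `afhfCap_n1_U16p7_at` (monotone in `U`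 below); floor = kernel Fermi-sea rows at `2n₀ = 199/100` on the columns `-3/10 | -1/4 | -1/5`; exact piece margins `+0.1815`, `+0.1835`. [cite: LiebLoss1993, §8, Theorem 8.2] [cite: Tasaki1998, §2 Def. 2.1, §6 Thm. 6.1] [cite: BachLiebSolovej1994, eq. (2c.36)] -/
theorem laP_x0_lt_polarised {t' U n : ℝ} (ht1 : -3 / 10 ≤ t') (ht2 : t' ≤ -1 / 5) (hU0 : 0 ≤ U) (hU : U ≤ 167 / 10)
    (hn1 : 99 / 100 ≤ n) (hn2 : n < 1) :
    energyDensityTT' 1 t' U n < 1 / 2 * energyDensityTT' 1 t' 0 (2 * n) := by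
  have hn0 : (0 : ℝ) ≤ n := by linarith
  have hn2' : n < 2 := by linarith
  have hnpos : (0 : ℝ) < n := by linarith
  have h2n0 : (0 : ℝ) ≤ 2 * n := by linarith
  have h2n2 : 2 * n < 2 := by linarith
  have hcap := objE_vacChord_cap (by norm_num : (0 : ℝ) ≤ 167 / 10) (afhfCap_n1_U16p7_at t' (by norm_num : (0 : ℝ) ≤ 167 / 10) le_rfl) hnpos (by linarith)
  have r0 := fermiSeaTangentRow_tPrime_neg_three_div_ten_at_hundredninetynine_div_hundred (U := 0) le_rfl h2n0 h2n2
  have r1 := fermiSeaTangentRow_tPrime_neg_one_div_four_at_hundredninetynine_div_hundred (U := 0) le_rfl h2n0 h2n2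
  have r2 := fermiSeaTangentRow_tPrime_neg_one_div_five_at_hundredninetynine_div_hundred (U := 0) le_rfl h2n0 h2n2
  rcases le_or_gt t' (-1 / 4) with hp0 | hp0
  · have hfl := objE_floor_between (s := t') h2n0 h2n2 (by norm_num : (-3 / 10 : ℝ) ≤ -1 / 4) r0 r1 (by linarith) hp0
    exact polar_word_of_cap hU0 hU hn0 hn2' hcap hfl (by linarith) (by linarith)
  · -- `t' > -1/4`
    have hfl := objE_floor_between (s := t') h2n0 h2n2 (by norm_num : (-1 / 4 : ℝ) ≤ -1 / 5) r1 r2 hp0.le (by linarith)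
    exact polar_word_of_cap hU0 hU hn0 hn2' hcap hfl (by linarith) (by linarith)

/-- **La₁.₉₇Sr₀.₀₃CuO₄ x = 0.03, `t' ∈ [-3/10, -1/5]`, `n ∈ [97/100, 99/100]`: the SATURATED-FM class is excluded for every `0 ≤ U ≤ 167/10`, HYPOTHESIS-FREE** (box `U/t_eff ∈ [5.9, 14.7]`; before: laE_x003_lt_polarised_of (whole box; cond.)): `e(1, t', U, n) < ½·e(1, t', 0, 2n)` = the one-species bathtub floor of every fully polarised state. Cap at `U = 167/10` = vacuum chord `n·C` of hubbard-box-p2's KERNEL AF-Hartree–Fock half-filling cap `afhfCap_n1_U16p7_at` (monotone in `U` below); floor = kernel Fermi-sea rows at `2n₀ = 199/100` on the columns `-3/10 | -1/4 | -1/5`; exact piece margins `+0.0747`, `+0.0806`. [cite: LiebLoss1993, §8, Theorem 8.2] [cite: Tasaki1998, §2 Def. 2.1, §6 Thm. 6.1] [cite: BachLiebSolovej1994, eq. (2c.36)] -/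
theorem laP_x003_hi_lt_polarised {t' U n : ℝ} (ht1 : -3 / 10 ≤ t') (ht2 : t' ≤ -1 / 5) (hU0 : 0 ≤ U) (hU : U ≤ 167 / 10)
    (hn1 : 97 / 100 ≤ n) (hn2 : n ≤ 99 / 100) :
    energyDensityTT' 1 t' U n < 1 / 2 * energyDensityTT' 1 t' 0 (2 * n) := by
  have hn0 : (0 : ℝ) ≤ n := by linarith
  have hn2' : n < 2 := by linarith
  have hnpos : (0 : ℝ) < n := by linarith
  have h2n0 : (0 : ℝ) ≤ 2 * n := by linarith
  have h2n2 : 2 * n < 2 := by linarith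
  have hcap := objE_vacChord_cap (by norm_num : (0 : ℝ) ≤ 167 / 10) (afhfCap_n1_U16p7_at t' (by norm_num : (0 : ℝ) ≤ 167 / 10) le_rfl) hnpos (by linarith)
  have r0 := fermiSeaTangentRow_tPrime_neg_three_div_ten_at_hundredninetynine_div_hundred (U := 0) le_rfl h2n0 h2n2
  have r1 := fermiSeaTangentRow_tPrime_neg_one_div_four_at_hundredninetynine_div_hundred (U := 0) le_rfl h2n0 h2n2
  have r2 := fermiSeaTangentRow_tPrime_neg_one_div_five_at_hundredninetynine_div_hundred (U := 0) le_rfl h2n0 h2n2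
  rcases le_or_gt t' (-1 / 4) with hp0 | hp0
  · have hfl := objE_floor_between (s := t') h2n0 h2n2 (by norm_num : (-3 / 10 : ℝ) ≤ -1 / 4) r0 r1 (by linarith) hp0
    exact polar_word_of_cap hU0 hU hn0 hn2' hcap hfl (by linarith) (by linarith)
  · -- `t' > -1/4`
    have hfl := objE_floor_between (s := t') h2n0 h2n2 (by norm_num : (-1 / 4 : ℝ) ≤ -1 / 5) r1 r2 hp0.le (by linarith)
    exact polar_word_of_cap hU0 hU hn0 hn2' hcap hfl (by linarith) (by linarith)

/-- **La₁.₉₇Sr₀.₀₃CuO₄ x = 0.03, `t' ∈ [-3/10, -1/5]`, `n ∈ [19/20, 97/100]`: the SATURATED-FM class is excluded for every `0 ≤ U ≤ 147/10`, HYPOTHESIS-FREE** (box `U/t_eff ∈ [5.9, 14.7]`; before: laE_x003_lt_polarised_of (whole box; cond.)): `e(1, t', U, n) < ½·e(1, t', 0, 2n)` = the one-species bathtub floor of every fully polarised state. Cap at `U = 147/10` = vacuum chord `n·C` of hubbard-box-p2's KERNEL AF-Hartree–Fock half-filling cap `afhfCap_n1_U14p7_at` (monotone in `U` below); floor = kernel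 Fermi-sea rows at `2n₀ = 93/50` on the columns `-3/10 | -1/4 | -1/5`; exact piece margins `+0.0132`, `+0.0219`. [cite: LiebLoss1993, §8, Theorem 8.2] [cite: Tasaki1998, §2 Def. 2.1, §6 Thm. 6.1] [cite: BachLiebSolovej1994, eq. (2c.36)] -/
theorem laP_x003_lo_lt_polarised {t' U n : ℝ} (ht1 : -3 / 10 ≤ t') (ht2 : t' ≤ -1 / 5) (hU0 : 0 ≤ U) (hU : U ≤ 147 / 10)
    (hn1 : 19 / 20 ≤ n) (hn2 : n ≤ 97 / 100) :
    energyDensityTT' 1 t' U n < 1 / 2 * energyDensityTT' 1 t' 0 (2 * n) := by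
  have hn0 : (0 : ℝ) ≤ n := by linarith
  have hn2' : n < 2 := by linarith
  have hnpos : (0 : ℝ) < n := by linarith
  have h2n0 : (0 : ℝ) ≤ 2 * n := by linarith
  have h2n2 : 2 * n < 2 := by linarith
  have hcap := objE_vacChord_cap (by norm_num : (0 : ℝ) ≤ 147 / 10) (afhfCap_n1_U14p7_at t' (by norm_num : (0 : ℝ) ≤ 147 / 10) le_rfl) hnpos (by linarith)
  have r0 := fermiSeaTangentRow_tPrime_neg_three_div_ten_at_ninetythree_div_fifty (U := 0) le_rfl h2n0 h2n2
  have r1 := fermiSeaTangentRow_tPrime_neg_one_div_four_at_ninetythree_div_fifty (U := 0) le_rfl h2n0 h2n2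
  have r2 := fermiSeaTangentRow_tPrime_neg_one_div_five_at_ninetythree_div_fifty (U := 0) le_rfl h2n0 h2n2
  rcases le_or_gt t' (-1 / 4) with hp0 | hp0
  · have hfl := objE_floor_between (s := t') h2n0 h2n2 (by norm_num : (-3 / 10 : ℝ) ≤ -1 / 4) r0 r1 (by linarith) hp0
    exact polar_word_of_cap hU0 hU hn0 hn2' hcap hfl (by linarith) (by linarith)
  · -- `t' > -1/4`
    have hfl := objE_floor_between (s := t') h2n0 h2n2 (by norm_num : (-1 / 4 : ℝ) ≤ -1 / 5) r1 r2 hp0.le (by linarith)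
    exact polar_word_of_cap hU0 hU hn0 hn2' hcap hfl (by linarith) (by linarith)

/-- **La₁.₉₅Sr₀.₀₅CuO₄ x = 0.05, `t' ∈ [-3/10, -1/5]`, `n ∈ [93/100, 97/100]`: the SATURATED-FM class is excluded for every `0 ≤ U ≤ 10`, HYPOTHESIS-FREE** (box `U/t_eff ∈ [5.9, 14.7]`; before: laE_x005_lt_polarised_U10_of (U ≤ 10; cond. #471)): `e(1, t', U, n) < ½·e(1, t', 0, 2n)` = the one-species bathtub floor of every fully polarised state. Cap at `U = 10` = vacuum chord `n·C` of hubbard-box-p2's KERNEL AF-Hartree–Fock half-filling cap `afhfCap_n1_U10_at` (monotone in `U` below); floor = kernel Fermi-sea rows at `2n₀ = 93/50` on the columns `-3/10 | -1/4 | -1/5`; exact piece margins `+0.0370`, `+0.0482`. [cite: LiebLoss1993, §8, Theorem 8.2] [cite: Tasaki1998, §2 Def. 2.1, §6 Thm. 6.1] [cite: BachLiebSolovej1994, eq. (2c.36)] -/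
theorem laP_x005_lt_polarised {t' U n : ℝ} (ht1 : -3 / 10 ≤ t') (ht2 : t' ≤ -1 / 5) (hU0 : 0 ≤ U) (hU : U ≤ 10)
    (hn1 : 93 / 100 ≤ n) (hn2 : n ≤ 97 / 100) :
    energyDensityTT' 1 t' U n < 1 / 2 * energyDensityTT' 1 t' 0 (2 * n) := by
  have hn0 : (0 : ℝ) ≤ n := by linarith
  have hn2' : n < 2 := by linarith
  have hnpos : (0 : ℝ) < n := by linarith
  have h2n0 : (0 : ℝ) ≤ 2 * n := by linarith
  have h2n2 : 2 * n < 2 := by linarith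
  have hcap := objE_vacChord_cap (by norm_num : (0 : ℝ) ≤ 10) (afhfCap_n1_U10_at t' (by norm_num : (0 : ℝ) ≤ 10) le_rfl) hnpos (by linarith)
  have r0 := fermiSeaTangentRow_tPrime_neg_three_div_ten_at_ninetythree_div_fifty (U := 0) le_rfl h2n0 h2n2
  have r1 := fermiSeaTangentRow_tPrime_neg_one_div_four_at_ninetythree_div_fifty (U := 0) le_rfl h2n0 h2n2
  have r2 := fermiSeaTangentRow_tPrime_neg_one_div_five_at_ninetythree_div_fifty (U := 0) le_rfl h2n0 h2n2
  rcases le_or_gt t' (-1 / 4) with hp0 | hp0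
  · have hfl := objE_floor_between (s := t') h2n0 h2n2 (by norm_num : (-3 / 10 : ℝ) ≤ -1 / 4) r0 r1 (by linarith) hp0
    exact polar_word_of_cap hU0 hU hn0 hn2' hcap hfl (by linarith) (by linarith)
  · -- `t' > -1/4`
    have hfl := objE_floor_between (s := t') h2n0 h2n2 (by norm_num : (-1 / 4 : ℝ) ≤ -1 / 5) r1 r2 hp0.le (by linarith)
    exact polar_word_of_cap hU0 hU hn0 hn2' hcap hfl (by linarith) (by linarith)

/-- **La₁.₉₃Sr₀.₀₇CuO₄ x = 0.07 (VSET M14), `t' ∈ [-3/10, -1/5]`, `n ∈ [91/100, 19/20]`: the SATURATED-FM class is excluded for every `0 ≤ U ≤ 17/2`, HYPOTHESIS-FREE** (box `U/t_eff ∈ [5.9, 14.7]`; before: laE_x007_lt_polarised_U10_of (U ≤ 10; cond. #471 + docc tangent)): `e(1, t', U, n) < ½·e(1, t', 0, 2n)` = the one-species bathtub floor of every fully polarised state. Cap at `U = 17/2` = vacuum chord `n·C` of hubbard-box-p2's KERNEL AF-Hartree–Fock half-filling cap `afhfCap_n1_U8p5_at` (monotone in `U` below); floor = kernel Fermi-sea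 rows at `2n₀ = 93/50` on the columns `-3/10 | -1/4 | -1/5`; exact piece margins `+0.0054`, `+0.0190`. [cite: LiebLoss1993, §8, Theorem 8.2] [cite: Tasaki1998, §2 Def. 2.1, §6 Thm. 6.1] [cite: BachLiebSolovej1994, eq. (2c.36)] -/
theorem laP_x007_lt_polarised {t' U n : ℝ} (ht1 : -3 / 10 ≤ t') (ht2 : t' ≤ -1 / 5) (hU0 : 0 ≤ U) (hU : U ≤ 17 / 2)
    (hn1 : 91 / 100 ≤ n) (hn2 : n ≤ 19 / 20) :
    energyDensityTT' 1 t' U n < 1 / 2 * energyDensityTT' 1 t' 0 (2 * n) := by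
  have hn0 : (0 : ℝ) ≤ n := by linarith
  have hn2' : n < 2 := by linarith
  have hnpos : (0 : ℝ) < n := by linarith
  have h2n0 : (0 : ℝ) ≤ 2 * n := by linarith
  have h2n2 : 2 * n < 2 := by linarith
  have hcap := objE_vacChord_cap (by norm_num : (0 : ℝ) ≤ 17 / 2) (afhfCap_n1_U8p5_at t' (by norm_num : (0 : ℝ) ≤ 17 / 2) le_rfl) hnpos (by linarith)
  have r0 := fermiSeaTangentRow_tPrime_neg_three_div_ten_at_ninetythree_div_fifty (U := 0) le_rfl h2n0 h2n2
  have r1 := fermiSeaTangentRow_tPrime_neg_one_div_four_at_ninetythree_div_fifty (U := 0) le_rfl h2n0 h2n2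
  have r2 := fermiSeaTangentRow_tPrime_neg_one_div_five_at_ninetythree_div_fifty (U := 0) le_rfl h2n0 h2n2
  rcases le_or_gt t' (-1 / 4) with hp0 | hp0
  · have hfl := objE_floor_between (s := t') h2n0 h2n2 (by norm_num : (-3 / 10 : ℝ) ≤ -1 / 4) r0 r1 (by linarith) hp0
    exact polar_word_of_cap hU0 hU hn0 hn2' hcap hfl (by linarith) (by linarith)
  · -- `t' > -1/4`
    have hfl := objE_floor_between (s := t') h2n0 h2n2 (by norm_num : (-1 / 4 : ℝ) ≤ -1 / 5) r1 r2 hp0.le (by linarith)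
    exact polar_word_of_cap hU0 hU hn0 hn2' hcap hfl (by linarith) (by linarith)

/-- **Ca₂CuO₂Cl₂ parent (VSET M58), BOX #28 object E `[7.1, 12.4] × [−0.41, −0.30]`, hole half, `t' ∈ [-41/100, -3/10]`, `n ∈ [99/100, 1)`: the SATURATED-FM class is excluded for every `0 ≤ U ≤ 167/10`, HYPOTHESIS-FREE** (box `U/t_eff ∈ [7.1, 12.4]`; before: ccocE_parent_lt_polarised_of (WHOLE box U ≤ 16; cond. #469)): `e(1, t', U, n) < ½·e(1, t', 0, 2n)` = the one-species bathtub floor of every fully polarised state. Cap at `U = 167/10` = vacuum chord `n·C` of hubbard-box-p2's KERNEL AF-Hartree–Fock half-filling cap `afhfCap_n1_U16p7_at` (monotone in `U` below); floor = kernel Fermi-sea rows at `2n₀ = 199/100` on the columns `-1/2 | -2/5 | -3/10`; exact piece margins `+0.1737`, `+0.1776`. [cite: LiebLoss1993, §8, Theorem 8.2] [cite: Tasaki1998, §2 Def. 2.1, §6 Thm. 6.1] [cite: BachLiebSolovej1994, eq. (2c.36)] -/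
theorem ccocP_parent_lt_polarised {t' U n : ℝ} (ht1 : -41 / 100 ≤ t') (ht2 : t' ≤ -3 / 10) (hU0 : 0 ≤ U) (hU : U ≤ 167 / 10)
    (hn1 : 99 / 100 ≤ n) (hn2 : n < 1) :
    energyDensityTT' 1 t' U n < 1 / 2 * energyDensityTT' 1 t' 0 (2 * n) := by
  have hn0 : (0 : ℝ) ≤ n := by linarith
  have hn2' : n < 2 := by linarith
  have hnpos : (0 : ℝ) < n := by linarith
  have h2n0 : (0 : ℝ) ≤ 2 * n := by linarith
  have h2n2 : 2 * n < 2 := by linarith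
  have hcap := objE_vacChord_cap (by norm_num : (0 : ℝ) ≤ 167 / 10) (afhfCap_n1_U16p7_at t' (by norm_num : (0 : ℝ) ≤ 167 / 10) le_rfl) hnpos (by linarith)
  have r0 := fermiSeaTangentRow_tPrime_neg_one_div_two_at_hundredninetynine_div_hundred (U := 0) le_rfl h2n0 h2n2
  have r1 := fermiSeaTangentRow_tPrime_neg_two_div_five_at_hundredninetynine_div_hundred (U := 0) le_rfl h2n0 h2n2
  have r2 := fermiSeaTangentRow_tPrime_neg_three_div_ten_at_hundredninetynine_div_hundred (U := 0) le_rfl h2n0 h2n2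
  rcases le_or_gt t' (-2 / 5) with hp0 | hp0
  · have hfl := objE_floor_between (s := t') h2n0 h2n2 (by norm_num : (-1 / 2 : ℝ) ≤ -2 / 5) r0 r1 (by linarith) hp0
    exact polar_word_of_cap hU0 hU hn0 hn2' hcap hfl (by linarith) (by linarith)
  · -- `t' > -2/5`
    have hfl := objE_floor_between (s := t') h2n0 h2n2 (by norm_num : (-2 / 5 : ℝ) ≤ -3 / 10) r1 r2 hp0.le (by linarith)
    exact polar_word_of_cap hU0 hU hn0 hn2' hcap hfl (by linarith) (by linarith)

/-- **Nd₂CuO₄ T′ parent (VSET M56), object E hole half direct `[2.17, 7.24] × [−0.57, −0.46]`, `t' ∈ [-57/100, -23/50]`, `n ∈ [99/100, 1)`: the SATURATED-FM class is excluded for every `0 ≤ U ≤ 12`, HYPOTHESIS-FREE** (box `U/t_eff ∈ [2.17, 7.24]`; before: ncoE_parent_lt_polarised_of (WHOLE box U ≤ 16; cond. #469)): `e(1, t', U, n) < ½·e(1, t', 0, 2n)` = the one-species bathtub floor of every fully polarised state. Cap at `U = 12` = vacuum chord `n·C` of hubbard-box-p2's KERNEL AF-Hartree–Fock half-filling cap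 `afhfCap_n1_U12_at` (monotone in `U` below); floor = kernel Fermi-sea rows at `2n₀ = 199/100` on the columns `-57/100 | -23/50`; exact piece margins `+0.2253`. [cite: LiebLoss1993, §8, Theorem 8.2] [cite: Tasaki1998, §2 Def. 2.1, §6 Thm. 6.1] [cite: BachLiebSolovej1994, eq. (2c.36)] -/
theorem ncoP_parent_lt_polarised {t' U n : ℝ} (ht1 : -57 / 100 ≤ t') (ht2 : t' ≤ -23 / 50) (hU0 : 0 ≤ U) (hU : U ≤ 12)
    (hn1 : 99 / 100 ≤ n) (hn2 : n < 1) :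
    energyDensityTT' 1 t' U n < 1 / 2 * energyDensityTT' 1 t' 0 (2 * n) := by
  have hn0 : (0 : ℝ) ≤ n := by linarith
  have hn2' : n < 2 := by linarith
  have hnpos : (0 : ℝ) < n := by linarith
  have h2n0 : (0 : ℝ) ≤ 2 * n := by linarith
  have h2n2 : 2 * n < 2 := by linarith
  have hcap := objE_vacChord_cap (by norm_num : (0 : ℝ) ≤ 12) (afhfCap_n1_U12_at t' (by norm_num : (0 : ℝ) ≤ 12) le_rfl) hnpos (by linarith)
  have r0 := fermiSeaRow4_tPrime_neg_fiftyseven_div_hundred_at_hundredninetynine_div_hundred (U := 0) le_rfl h2n0 h2n2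
  have r1 := fermiSeaRow4_tPrime_neg_twentythree_div_fifty_at_hundredninetynine_div_hundred (U := 0) le_rfl h2n0 h2n2
  have hfl := objE_floor_between (s := t') h2n0 h2n2 (by norm_num : (-57 / 100 : ℝ) ≤ -23 / 50) r0 r1 (by linarith) (by linarith)
  exact polar_word_of_cap hU0 hU hn0 hn2' hcap hfl (by linarith) (by linarith)

/-- **Nd₂CuO₄ T′ parent (VSET M56), electron half via the image `t′ ∈ [0.46, 0.57]`, `t' ∈ [23/50, 57/100]`, `n ∈ [99/100, 1)`: the SATURATED-FM class is excluded for every `0 ≤ U ≤ 12`, HYPOTHESIS-FREE** (box `U/t_eff ∈ [2.17, 7.24]`; before: ncoE_parent_image_lt_polarised_of (WHOLE box U ≤ 16; cond. #469)): `e(1, t', U, n) < ½·e(1, t', 0, 2n)` = the one-species bathtub floor of every fully polarised state. Cap at `U = 12` = vacuum chord `n·C` of hubbard-box-p2's KERNEL AF-Hartree–Fock half-filling cap `afhfCap_n1_U12_at` (monotone in `U` below); floor = kernel Fermi-sea rows at `2n₀ = 199/100` on the columns `23/50 | 57/100`; exact piece margins `+0.2641`. [cite: LiebLoss1993, §8,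 Theorem 8.2] [cite: Tasaki1998, §2 Def. 2.1, §6 Thm. 6.1] [cite: BachLiebSolovej1994, eq. (2c.36)] -/
theorem ncoP_parent_image_lt_polarised {t' U n : ℝ} (ht1 : 23 / 50 ≤ t') (ht2 : t' ≤ 57 / 100) (hU0 : 0 ≤ U) (hU : U ≤ 12)
    (hn1 : 99 / 100 ≤ n) (hn2 : n < 1) :
    energyDensityTT' 1 t' U n < 1 / 2 * energyDensityTT' 1 t' 0 (2 * n) := by
  have hn0 : (0 : ℝ) ≤ n := by linarith
  have hn2' : n < 2 := by linarith
  have hnpos : (0 : ℝ) < n := by linarith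
  have h2n0 : (0 : ℝ) ≤ 2 * n := by linarith
  have h2n2 : 2 * n < 2 := by linarith
  have hcap := objE_vacChord_cap (by norm_num : (0 : ℝ) ≤ 12) (afhfCap_n1_U12_at t' (by norm_num : (0 : ℝ) ≤ 12) le_rfl) hnpos (by linarith)
  have r0 := fermiSeaRow4_tPrime_twentythree_div_fifty_at_hundredninetynine_div_hundred (U := 0) le_rfl h2n0 h2n2
  have r1 := fermiSeaRow4_tPrime_fiftyseven_div_hundred_at_hundredninetynine_div_hundred (U := 0) le_rfl h2n0 h2n2
  have hfl := objE_floor_between (s := t') h2n0 h2n2 (by norm_num : (23 / 50 : ℝ) ≤ 57 / 100) r0 r1 (by linarith) (by linarith)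
  exact polar_word_of_cap hU0 hU hn0 hn2' hcap hfl (by linarith) (by linarith)

/-- **Nd₁.₈₅Ce₀.₁₅CuO₄ (VSET M20), PH-image face `t′ ∈ [0.51, 0.62]` of the object-E box `[2.4, 8.23] × [−0.62, −0.51] × [1.09, 1.17]`, `t' ∈ [51/100, 31/50]`, `n ∈ [83/100, 91/100]`: the SATURATED-FM class is excluded for every `0 ≤ U ≤ 7`, HYPOTHESIS-FREE** (box `U/t_eff ∈ [2.4, 8.23]`; before: nccoE_x015_lt_polarised_U8_of (U ≤ 8; cond. #472) / nccoE_x015_lt_polarised_of (U ≤ 6; cond. #21)): `e(1, t', U, n) < ½·e(1, t', 0, 2n)` = the one-species bathtub floor of every fully polarised state. Cap at `U = 7` = vacuum chord `n·C` of hubbard-box-p2's KERNEL AF-Hartree–Fock half-filling cap `afhfCap_n1_U7_at` (monotone in `U` below); floor = kernel Fermi-sea rows at `2n₀ = 9/5` on the columns `49/100 | 27/50 | 3/5 | 31/50`; exact piece margins `+0.0609`, `+0.0385`, `+0.0297`. [cite: LiebLoss1993, §8, Theorem 8.2] [cite: Tasaki1998, §2 Def. 2.1, §6 Thm. 6.1]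 [cite: BachLiebSolovej1994, eq. (2c.36)] -/
theorem nccoP_x015_lt_polarised {t' U n : ℝ} (ht1 : 51 / 100 ≤ t') (ht2 : t' ≤ 31 / 50) (hU0 : 0 ≤ U) (hU : U ≤ 7)
    (hn1 : 83 / 100 ≤ n) (hn2 : n ≤ 91 / 100) :
    energyDensityTT' 1 t' U n < 1 / 2 * energyDensityTT' 1 t' 0 (2 * n) := by
  have hn0 : (0 : ℝ) ≤ n := by linarith
  have hn2' : n < 2 := by linarith
  have hnpos : (0 : ℝ) < n := by linarith
  have h2n0 : (0 : ℝ) ≤ 2 * n := by linarith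
  have h2n2 : 2 * n < 2 := by linarith
  have hcap := objE_vacChord_cap (by norm_num : (0 : ℝ) ≤ 7) (afhfCap_n1_U7_at t' (by norm_num : (0 : ℝ) ≤ 7) le_rfl) hnpos (by linarith)
  have r0 := fermiSeaRow4_tPrime_fortynine_div_hundred_at_nine_div_five (U := 0) le_rfl h2n0 h2n2
  have r1 := fermiSeaRow4_tPrime_twentyseven_div_fifty_at_nine_div_five (U := 0) le_rfl h2n0 h2n2
  have r2 := fermiSeaRow4_tPrime_three_div_five_at_nine_div_five (U := 0) le_rfl h2n0 h2n2
  have r3 := fermiSeaRow4_tPrime_thirtyone_div_fifty_at_nine_div_five (U := 0) le_rfl h2n0 h2n2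
  rcases le_or_gt t' (27 / 50) with hp0 | hp0
  · have hfl := objE_floor_between (s := t') h2n0 h2n2 (by norm_num : (49 / 100 : ℝ) ≤ 27 / 50) r0 r1 (by linarith) hp0
    exact polar_word_of_cap hU0 hU hn0 hn2' hcap hfl (by linarith) (by linarith)
  · -- `t' > 27/50`
    rcases le_or_gt t' (3 / 5) with hp1 | hp1
    · have hfl := objE_floor_between (s := t') h2n0 h2n2 (by norm_num : (27 / 50 : ℝ) ≤ 3 / 5) r1 r2 hp0.le hp1
      exact polar_word_of_cap hU0 hU hn0 hn2' hcap hfl (by linarith) (by linarith)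
    · -- `t' > 3/5`
      have hfl := objE_floor_between (s := t') h2n0 h2n2 (by norm_num : (3 / 5 : ℝ) ≤ 31 / 50) r2 r3 hp1.le (by linarith)
      exact polar_word_of_cap hU0 hU hn0 hn2' hcap hfl (by linarith) (by linarith)

/-- **Nd₁.₉Ce₀.₁CuO₄ (VSET M55, control), PH-image face `t′ ∈ [0.49, 0.62]` ⊇ [0.499, 0.613] of the object-E box `[2.41, 8.37]`, `t' ∈ [49/100, 31/50]`, `n ∈ [22/25, 47/50]`: the SATURATED-FM class is excluded for every `0 ≤ U ≤ 10`, HYPOTHESIS-FREE** (box `U/t_eff ∈ [2.41, 8.37]`; before: nccoE_x010_lt_polarised_U10_of (U ≤ 10 ⊇ whole box; cond. #471)): `e(1, t', U, n) < ½·e(1, t', 0, 2n)` = the one-species bathtub floor of every fully polarised state. Cap at `U = 10` = vacuum chord `n·C` of hubbard-box-p2's KERNEL AF-Hartree–Fock half-filling cap `afhfCap_n1_U10_at` (monotone in `U` below); floor = kernel Fermi-sea rows at `2n₀ = 9/5` on the columns `49/100 | 27/50 | 3/5 | 31/50`; exact piece margins `+0.0606`, `+0.0421`, `+0.0352`. [cite: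 LiebLoss1993, §8, Theorem 8.2] [cite: Tasaki1998, §2 Def. 2.1, §6 Thm. 6.1] [cite: BachLiebSolovej1994, eq. (2c.36)] -/
theorem nccoP_x010_lt_polarised {t' U n : ℝ} (ht1 : 49 / 100 ≤ t') (ht2 : t' ≤ 31 / 50) (hU0 : 0 ≤ U) (hU : U ≤ 10)
    (hn1 : 22 / 25 ≤ n) (hn2 : n ≤ 47 / 50) :
    energyDensityTT' 1 t' U n < 1 / 2 * energyDensityTT' 1 t' 0 (2 * n) := by
  have hn0 : (0 : ℝ) ≤ n := by linarith
  have hn2' : n < 2 := by linarith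
  have hnpos : (0 : ℝ) < n := by linarith
  have h2n0 : (0 : ℝ) ≤ 2 * n := by linarith
  have h2n2 : 2 * n < 2 := by linarith
  have hcap := objE_vacChord_cap (by norm_num : (0 : ℝ) ≤ 10) (afhfCap_n1_U10_at t' (by norm_num : (0 : ℝ) ≤ 10) le_rfl) hnpos (by linarith)
  have r0 := fermiSeaRow4_tPrime_fortynine_div_hundred_at_nine_div_five (U := 0) le_rfl h2n0 h2n2
  have r1 := fermiSeaRow4_tPrime_twentyseven_div_fifty_at_nine_div_five (U := 0) le_rfl h2n0 h2n2
  have r2 := fermiSeaRow4_tPrime_three_div_five_at_nine_div_five (U := 0) le_rfl h2n0 h2n2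
  have r3 := fermiSeaRow4_tPrime_thirtyone_div_fifty_at_nine_div_five (U := 0) le_rfl h2n0 h2n2
  rcases le_or_gt t' (27 / 50) with hp0 | hp0
  · have hfl := objE_floor_between (s := t') h2n0 h2n2 (by norm_num : (49 / 100 : ℝ) ≤ 27 / 50) r0 r1 (by linarith) hp0
    exact polar_word_of_cap hU0 hU hn0 hn2' hcap hfl (by linarith) (by linarith)
  · -- `t' > 27/50`
    rcases le_or_gt t' (3 / 5) with hp1 | hp1
    · have hfl := objE_floor_between (s := t') h2n0 h2n2 (by norm_num : (27 / 50 : ℝ) ≤ 3 / 5) r1 r2 hp0.le hp1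
      exact polar_word_of_cap hU0 hU hn0 hn2' hcap hfl (by linarith) (by linarith)
    · -- `t' > 3/5`
      have hfl := objE_floor_between (s := t') h2n0 h2n2 (by norm_num : (3 / 5 : ℝ) ≤ 31 / 50) r2 r3 hp1.le (by linarith)
      exact polar_word_of_cap hU0 hU hn0 hn2' hcap hfl (by linarith) (by linarith)

/-- **Sr₀.₉La₀.₁CuO₂ (VSET M37), PH-image face `t′ ∈ [0.54, 0.65]` of the object-E box `[2.42, 11.24]`, `t' ∈ [27/50, 13/20]`, `n ∈ [89/100, 91/100]`: the SATURATED-FM class is excluded for every `0 ≤ U ≤ 10`, HYPOTHESIS-FREE** (box `U/t_eff ∈ [2.42, 11.24]`; before: slcoE_x010_lt_polarised_of (U ≤ 12 ⊇ whole box; cond. #470)): `e(1, t', U, n) < ½·e(1, t', 0, 2n)` = the one-species bathtub floor of every fully polarised state. Cap at `U = 10` = vacuum chord `n·C` of hubbard-box-p2's KERNEL AF-Hartree–Fock half-filling cap `afhfCap_n1_U10_at` (monotone in `U` below); floor = kernel Fermi-sea rows at `2n₀ = 9/5` on the columns `27/50 | 3/5 | 13/20`; exact piece margins `+0.0662`,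 `+0.0494`. [cite: LiebLoss1993, §8, Theorem 8.2] [cite: Tasaki1998, §2 Def. 2.1, §6 Thm. 6.1] [cite: BachLiebSolovej1994, eq. (2c.36)] -/
theorem slcoP_x010_lt_polarised {t' U n : ℝ} (ht1 : 27 / 50 ≤ t') (ht2 : t' ≤ 13 / 20) (hU0 : 0 ≤ U) (hU : U ≤ 10)
    (hn1 : 89 / 100 ≤ n) (hn2 : n ≤ 91 / 100) :
    energyDensityTT' 1 t' U n < 1 / 2 * energyDensityTT' 1 t' 0 (2 * n) := by
  have hn0 : (0 : ℝ) ≤ n := by linarith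
  have hn2' : n < 2 := by linarith
  have hnpos : (0 : ℝ) < n := by linarith
  have h2n0 : (0 : ℝ) ≤ 2 * n := by linarith
  have h2n2 : 2 * n < 2 := by linarith
  have hcap := objE_vacChord_cap (by norm_num : (0 : ℝ) ≤ 10) (afhfCap_n1_U10_at t' (by norm_num : (0 : ℝ) ≤ 10) le_rfl) hnpos (by linarith)
  have r0 := fermiSeaRow4_tPrime_twentyseven_div_fifty_at_nine_div_five (U := 0) le_rfl h2n0 h2n2
  have r1 := fermiSeaRow4_tPrime_three_div_five_at_nine_div_five (U := 0) le_rfl h2n0 h2n2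
  have r2 := fermiSeaRow4_tPrime_thirteen_div_twenty_at_nine_div_five (U := 0) le_rfl h2n0 h2n2
  rcases le_or_gt t' (3 / 5) with hp0 | hp0
  · have hfl := objE_floor_between (s := t') h2n0 h2n2 (by norm_num : (27 / 50 : ℝ) ≤ 3 / 5) r0 r1 (by linarith) hp0
    exact polar_word_of_cap hU0 hU hn0 hn2' hcap hfl (by linarith) (by linarith)
  · -- `t' > 3/5`
    have hfl := objE_floor_between (s := t') h2n0 h2n2 (by norm_num : (3 / 5 : ℝ) ≤ 13 / 20) r1 r2 hp0.le (by linarith)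
    exact polar_word_of_cap hU0 hU hn0 hn2' hcap hfl (by linarith) (by linarith)

end Summit.Ventures.CertifiedManyBodySolver.Observables

end
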